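import Literature.Geometry.Kaehler.ComplexTorusNefConeSemipositive
import HarnessLib

/-!
# Real Néron–Severi classes of a complex abelian variety: `NS(X)` is generated by polarisations, and a
# class of `NS_ℝ(X) = NS(X) ⊗ ℝ` is nef iff its hermitian form is positive semi-definite (the nef cone
# `Nef(X) ⊆ NS_ℝ(X)` of Bauer 1998, §4); `NS_ℝ(X) = N¹(X)_ℝ`

Layer `Literature/Geometry/Kaehler`, namespace `Literature.Geometry.Kaehler.ComplexTorus`; lane
`lit-hodgefound`, seat p07 (generation 43), programme «THE NEF CONE OF AN ABELIAN VARIETY», file 49 of the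
seat lineage; sequel of `ComplexTorusNefConeSemipositive` (file 48: for INTEGRAL classes `η ∈ NS(X)`, nef ⟺
`H_η ≥ 0` ⟺ effective — Bauer's Lemma 2.1). Theorems only (no definition, no named fact, no instance, no
notation; net debt `0`).

Bauer 1998, §4: "let `X` be an abelian variety and denote by `N_1(X)` the vector space of numerical
equivalence classes of real-valued 1-cycles on `X`, and by `NE(X)` the convex cone in `N_1(X)` generated by
irreducible curves. Through the intersection product the vector space `N_1(X)` is dual to the Néron-Severi
vector space `NS_ℝ(X) = NS(X) ⊗ ℝ`. The dual cone of `NE(X)` is the nef cone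
`Nef(X) = {λ ∈ NS_ℝ(X) | λξ ≥ 0 for all ξ ∈ NE(X)}`, which in the case of abelian varieties coincides with
the effective cone". In the tree `NS_ℝ(X)` is the real span `Submodule.span ℝ {η | IsNSForm Φ η}` of the
Néron–Severi group inside the invariant real `2`-forms (`NS(X) ⊆ H²(X, ℝ) = Alt²_ℝ(E; ℝ)`), a class
`θ ∈ NS_ℝ(X)` is nef when `∫_C ofRealForm(-θ) ≥ 0` for every irreducible curve `C`, and this file proves that
ON AN ABELIAN VARIETY THE NEF CONE IS THE CONE OF POSITIVE SEMI-DEFINITE CLASSES OF `NS_ℝ(X)`: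

* §1 **`NS(X)` is generated by polarisations**: for a polarisation `A` and `η ∈ NS(X)`, `η + mA` is a
  polarisation for `m ≫ 0` (`IsRiemannForm.exists_nat_isRiemannForm_add_smul`, positivity is open); hence
  every `η ∈ NS(X)` is a DIFFERENCE OF TWO POLARISATIONS (`IsAbelianVariety.exists_isRiemannForm_sub_eq`) and
  every `θ ∈ NS_ℝ(X)` is a real combination of polarisations
  (`IsAbelianVariety.exists_sum_smul_isRiemannForm_of_mem_span`) — the ample cone spans `NS_ℝ(X)`.
* §2 **`IsAbelianVariety.semipos_of_mem_span_isNSForm_of_forall_curve_nonneg`**: a nef `θ ∈ NS_ℝ(X)` has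
  `H_θ ≥ 0`. Proof (reduction to the integral case of file 48): write `θ = Σ cᵢ Aᵢ` with polarisations `Aᵢ`;
  for `b ∈ ℕ` put `aᵢ = ⌊b cᵢ⌋ + 1`, so that `ψ_b = Σ aᵢ Aᵢ = bθ + Σ (aᵢ - b cᵢ) Aᵢ ∈ NS(X)` is nef (a nef class
  plus a positive combination of polarisations), hence `H_{ψ_b} ≥ 0` by file 48; as `0 < aᵢ - b cᵢ ≤ 1`,
  `b·H_θ(v, v) ≥ -Σᵢ H_{Aᵢ}(v, v)` for every `b`, so `H_θ(v, v) ≥ 0`. With the converse (semi-positive ⇒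
  nef, any real `(1,1)`-form) this is **`IsAbelianVariety.semipos_iff_forall_curve_of_mem_span`**: the nef
  cone of `NS_ℝ(X)` is `{θ | H_θ ≥ 0}`, a closed convex cone containing the (open) ample cone `{H_θ > 0}` as a
  dense subset (`IsAbelianVariety.forall_pos_add_smul_of_forall_curve_nonneg`: `θ + εA > 0` for nef `θ`
  and every `ε > 0`), and Kleiman's theorem for real classes
  (`IsAbelianVariety.re_analyticCyclePeriod_wedgeFamily_nonneg_of_mem_span_of_forall_curve`: nef real classes
  integrate non-negatively on every subvariety).
* §3 **`NS_ℝ(X) = N¹(X)_ℝ`**: a class `θ ∈ NS_ℝ(X)` with `θ` and `-θ` nef is `0`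
  (`IsAbelianVariety.eq_zero_of_mem_span_isNSForm_of_forall_curve_nonneg_of_neg`: the nef cone is salient),
  hence NUMERICAL AND HOMOLOGICAL EQUIVALENCE COINCIDE FOR REAL DIVISOR CLASSES (Matsusaka with real
  coefficients, `IsAbelianVariety.eq_zero_of_mem_span_isNSForm_of_forall_curve_(re_)eq_zero`,
  `IsAbelianVariety.eq_iff_forall_curve_of_mem_span_isNSForm` — "`N_1(X)` is dual to `NS_ℝ(X)`"), and the nef
  cone is the closure of the ample cone (`IsAbelianVariety.forall_curve_nonneg_iff_forall_pos_add_smul_pos`: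
  nef ⟺ `θ + εA > 0` for all `ε > 0`).
* §4 **Nef and big real classes are ample**: a nef `θ ∈ NS_ℝ(X)` with `(θ^g) = ∫_X (-θ)^{∧g} ≠ 0` has `H_θ > 0`
  (`IsAbelianVariety.forall_pos_of_mem_span_of_forall_curve_nonneg_of_torusIntegral_wedgePow_ne_zero`, via
  Cauchy–Schwarz and "`∧^g θ = 0` for degenerate `θ`"), and for nef real classes ample ⟺ big
  (`IsAbelianVariety.forall_pos_iff_torusIntegral_wedgePow_ne_zero_of_forall_curve_nonneg`).
* §5 **Bauer's nef threshold as printed**: for line bundles `L₁, L₂ ∈ NS(X)` and real `t`, "`tL₁ - L₂` is nef,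
  i.e. `tL₁C ≥ L₂C` for every irreducible curve `C`" ⟺ `H_{tL₁ - L₂} ≥ 0`
  (`IsAbelianVariety.forall_curve_le_smul_iff_semipos_smul_sub`); for polarisations the nef `t` form the
  half-line `[s, ∞)` with `s > 0` (`IsAbelianVariety.setOf_forall_curve_le_smul_eq_Ici`), and on a SIMPLE
  abelian variety `s ∉ ℚ` when the classes are not proportional — Prop. 2.2, assertion (2.1), verbatim
  (`IsSimple.irrational_sInf_setOf_forall_curve_le_smul`, from `ComplexTorusNefConeSemipositive` §9).
* §6 **Abelian surfaces** (`g = 2`; Debarre, 6.3: "`NE̅(X) = {z | z² ≥ 0, H·z ≥ 0}`"): for `θ ∈ NS_ℝ(X)` and a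
  polarisation `A`, nef ⟺ `(θ²) ≥ 0 ∧ (θ·A) ≥ 0`
  (`IsAbelianVariety.forall_curve_nonneg_iff_self_nonneg_and_dot_nonneg`; `⇐` by the degenerate endpoint of
  the segment `A + uθ` and bilinearity of the intersection form), effective ⟺ the same for `η ∈ NS(X)`
  (`IsAbelianVariety.exists_sum_analyticCycleClass_eq_iff_self_nonneg_and_dot_nonneg`), and ample ⟺
  `(θ²) > 0 ∧ (θ·A) > 0` (`IsAbelianVariety.forall_pos_iff_self_pos_and_dot_pos`).
* §7 **The cones in `NS_ℝ(X)`**: `Nef(X)` is a closed convex cone (`forall_curve_nonneg_add`,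
  `forall_curve_nonneg_smul`, `IsAbelianVariety.forall_curve_nonneg_of_mem_closure`),
  `Amp(X) + Nef(X) ⊆ Amp(X)` (`IsAbelianVariety.forall_pos_add_of_forall_curve_nonneg`, Debarre 1.22), and the
  numerical criteria for REAL classes (Debarre 1.28): nef ⟺ `Re (θ^ν · A^{g-ν}) ≥ 0` for `ν = 1, …, g`
  (`IsAbelianVariety.forall_curve_nonneg_iff_forall_re_torusIntegral_mixedFamily_nonneg_of_mem_span`, Bauer
  (ii) ⟺ (iii)), ample ⟺ `Re (θ^ν · A^{g-ν}) > 0` for `ν = 1, …, g`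
  (`IsAbelianVariety.forall_pos_iff_forall_re_torusIntegral_mixedFamily_pos_of_mem_span`, Cor. 2.2.3).

## References

* [Bauer1998ConeOfCurves] Th. Bauer, *On the cone of curves of an abelian variety*, Amer. J. Math. 120 (1998)
  997–1006, §4 (the nef cone `Nef(X) ⊆ NS_ℝ(X)`, dual of `NE(X)`, "coincides with the effective cone") and §2
  Lemma 2.1 (held: arXiv alg-geom/9712019, pp. 3, 5).
* [Lange2023AbelianVarietiesComplex] H. Lange, *Abelian Varieties over the Complex Numbers*, Springer 2023,
  §1.3.1 (the Néron–Severi group), §2.2.5 Exercises (1), (2), §4.6.3 (numerical classes).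
* [Debarre2001] O. Debarre, *Higher-Dimensional Algebraic Geometry*, Universitext, Springer 2001, §1.12
  Exercise 7; §6 no. 6.3 (the closed cone of curves of an abelian surface).
* [Huybrechts2005] D. Huybrechts, *Complex Geometry*, Springer 2005, §3.1 Cor. 3.1.8.
* [KollarMori1998] J. Kollár, S. Mori, *Birational Geometry of Algebraic Varieties*, Cambridge 1998, §1.4
  Def. 1.16–1.17 (`N_1(X)`, `NE(X)`), Thm. 1.18, Cor. 1.19 (held, p. 19).
* [Fulton1998] W. Fulton, *Intersection Theory*, 2nd ed., Springer 1998, §19.3 Example 19.3.3 (numerical vs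
  algebraic equivalence of divisors).
* [Decataldo2007] M. A. de Cataldo, *The Hodge theory of projective manifolds*, Imperial College Press 2007,
  Thm. 6.1.4.
-/

noncomputable section

open scoped Manifold ComplexOrder
open Complex Set Function Module Filter Topology

universe u

namespace Literature.Geometry.Kaehler

namespace ComplexTorus

/-! ### §1 `NS(X)` is generated by polarisations; `NS_ℝ(X)` is spanned by the ample cone -/

section Span

variable {ι : Type*} [Fintype ι] {E : Type*} [NormedAddCommGroup E] [NormedSpace ℂ E]
  (Φ : (ι → ℝ) ≃L[ℝ] E)

/-- **`η + mA` is a polarisation for `m ≫ 0`**: for a polarisation `A` and any `η ∈ NS(X)` there is `m ∈ ℕ`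
with `η + mA` a polarisation (positivity is an open condition: `A + δη > 0` for small `δ > 0`, and
`η + mA = δ⁻¹(A + δη) + (m - δ⁻¹)A`). [cite: Huybrechts2005, §3.1 Cor. 3.1.8]
[cite: Bauer1998ConeOfCurves, §2 Lemma 2.1 (proof: "`A + mL` is ample")] -/
theorem IsRiemannForm.exists_nat_isRiemannForm_add_smul {A η : E [⋀^Fin 2]→L[ℝ] ℝ} (hA : IsRiemannForm Φ A)
    (hη : IsNSForm Φ η) : ∃ m : ℕ, IsRiemannForm Φ (η + (m : ℝ) • A) := by
  haveI := finiteDimensional_complex Φ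
  obtain ⟨δ, hδ, hpd⟩ := exists_pos_forall_add_smul_apply_I_smul_self_pos hA.1 hA.2.2 hη.type_one_one
  obtain ⟨m, hm⟩ := exists_nat_gt δ⁻¹
  have hns : IsNSForm Φ (η + (m : ℝ) • A) := by
    refine hη.add ?_
    rw [Nat.cast_smul_eq_nsmul]
    exact (mem_neronSeveriGroup_iff Φ).1 (AddSubgroup.nsmul_mem _ ((mem_neronSeveriGroup_iff Φ).2 hA.isNSForm) m)
  refine ⟨m, hns.type_one_one, hns.integral, fun v hv ↦ ?_⟩
  have h1 := hpd v hv
  have h2 := hA.2.2 v hv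
  simp only [ContinuousAlternatingMap.add_apply, ContinuousAlternatingMap.smul_apply, smul_eq_mul] at h1 ⊢
  -- `η(iv,v) > -A(iv,v)/δ` and `m A(iv,v) > A(iv,v)/δ`
  have h3 : δ⁻¹ * A ![I • v, v] < m * A ![I • v, v] := mul_lt_mul_of_pos_right hm h2
  have h4 : 0 < δ⁻¹ * (A ![I • v, v] + δ * η ![I • v, v]) := mul_pos (inv_pos.2 hδ) h1
  have h5 : δ⁻¹ * (A ![I • v, v] + δ * η ![I • v, v]) = δ⁻¹ * A ![I • v, v] + η ![I • v, v] := by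
    field_simp
  linarith

/-- **Every Néron–Severi class of an abelian variety is a difference of two polarisations**
(`η = (η + mA) - mA`): `NS(X)` is generated, as a group, by the classes of ample line bundles.
[cite: Bauer1998ConeOfCurves, §2 Lemma 2.1 (proof: "`A + mL` is ample")] [cite: Lange2023AbelianVarietiesComplex, §2.2.5 Exercise (1)] -/
theorem IsAbelianVariety.exists_isRiemannForm_sub_eq (hX : IsAbelianVariety Φ) {η : E [⋀^Fin 2]→L[ℝ] ℝ}
    (hη : IsNSForm Φ η) :
    ∃ A₁ A₂ : E [⋀^Fin 2]→L[ℝ] ℝ, IsRiemannForm Φ A₁ ∧ IsRiemannForm Φ A₂ ∧ η = A₁ - A₂ := by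
  obtain ⟨A, hA⟩ := hX
  obtain ⟨m, hm⟩ := hA.exists_nat_isRiemannForm_add_smul Φ hη
  rcases Nat.eq_zero_or_pos m with h0 | hmpos
  · -- `m = 0`: `η` itself is a polarisation; `η = (η + A) - A`
    subst h0
    rw [Nat.cast_zero, zero_smul, add_zero] at hm
    obtain ⟨m', hm'⟩ := hA.exists_nat_isRiemannForm_add_smul Φ hA.isNSForm
    refine ⟨η + (A + (m' : ℝ) • A), A + (m' : ℝ) • A, ?_, hm', by abel⟩
    have hns : IsNSForm Φ (η + (A + (m' : ℝ) • A)) := hm.isNSForm.add hm'.isNSForm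
    refine ⟨hns.type_one_one, hns.integral, fun v hv ↦ ?_⟩
    rw [ContinuousAlternatingMap.add_apply]
    exact add_pos (hm.2.2 v hv) (hm'.2.2 v hv)
  · refine ⟨η + (m : ℝ) • A, (m : ℝ) • A, hm, ?_, by abel⟩
    have hns : IsNSForm Φ ((m : ℝ) • A) := by
      rw [Nat.cast_smul_eq_nsmul]
      exact (mem_neronSeveriGroup_iff Φ).1 (AddSubgroup.nsmul_mem _ ((mem_neronSeveriGroup_iff Φ).2 hA.isNSForm) m)
    refine ⟨hns.type_one_one, hns.integral, fun v hv ↦ ?_⟩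
    rw [ContinuousAlternatingMap.smul_apply, smul_eq_mul]
    exact mul_pos (by exact_mod_cast hmpos) (hA.2.2 v hv)

/-- **`NS_ℝ(X)` is spanned by polarisations**: on an abelian variety every `θ` in the real span of `NS(X)` is a
real linear combination `θ = Σᵢ cᵢ Aᵢ` of polarisations `Aᵢ` (the ample cone is open and non-empty in
`NS_ℝ(X)`, hence spans it). [cite: Bauer1998ConeOfCurves, §4 (the nef cone and `NS_ℝ(X) = NS(X) ⊗ ℝ`)]
[cite: Lange2023AbelianVarietiesComplex, §2.2.5 Exercise (1)] -/
theorem IsAbelianVariety.exists_sum_smul_isRiemannForm_of_mem_span (hX : IsAbelianVariety Φ)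
    {θ : E [⋀^Fin 2]→L[ℝ] ℝ} (hθ : θ ∈ Submodule.span ℝ {η : E [⋀^Fin 2]→L[ℝ] ℝ | IsNSForm Φ η}) :
    ∃ (n : ℕ) (c : Fin n → ℝ) (A : Fin n → E [⋀^Fin 2]→L[ℝ] ℝ),
      (∀ i, IsRiemannForm Φ (A i)) ∧ θ = ∑ i, c i • A i := by
  induction hθ using Submodule.span_induction with
  | mem η hη =>
    obtain ⟨A₁, A₂, h₁, h₂, rfl⟩ := hX.exists_isRiemannForm_sub_eq Φ hη
    refine ⟨2, ![1, -1], ![A₁, A₂], fun i ↦ by fin_cases i <;> assumption, ?_⟩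
    ext v
    simp only [ContinuousAlternatingMap.sub_apply, ContinuousAlternatingMap.add_apply,
      ContinuousAlternatingMap.smul_apply, Fin.sum_univ_two, Matrix.cons_val_zero, Matrix.cons_val_one, smul_eq_mul]
    ring
  | zero => exact ⟨0, Fin.elim0, Fin.elim0, fun i ↦ i.elim0, by simp⟩
  | add θ₁ θ₂ _ _ ih₁ ih₂ =>
    obtain ⟨n₁, c₁, A₁, hA₁, rfl⟩ := ih₁
    obtain ⟨n₂, c₂, A₂, hA₂, rfl⟩ := ih₂
    refine ⟨n₁ + n₂, Fin.append c₁ c₂, Fin.append A₁ A₂, fun i ↦ ?_, ?_⟩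
    · refine Fin.addCases (fun j ↦ ?_) (fun j ↦ ?_) i
      · simpa only [Fin.append_left] using hA₁ j
      · simpa only [Fin.append_right] using hA₂ j
    · rw [Fin.sum_univ_add]
      simp only [Fin.append_left, Fin.append_right]
  | smul r θ _ ih =>
    obtain ⟨n, c, A, hA, rfl⟩ := ih
    refine ⟨n, fun i ↦ r * c i, A, hA, ?_⟩
    rw [Finset.smul_sum]
    simp only [smul_smul]

omit [Fintype ι] in
/-- A real combination of `(1,1)`-forms is of type `(1,1)`. [folklore] -/
private theorem type_one_one_sum_smul {n : ℕ} (c : Fin n → ℝ) {A : Fin n → E [⋀^Fin 2]→L[ℝ] ℝ}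
    (hA : ∀ i (u v : E), A i ![I • u, I • v] = A i ![u, v]) (u v : E) :
    (∑ i, c i • A i) ![I • u, I • v] = (∑ i, c i • A i) ![u, v] := by
  simp only [ContinuousAlternatingMap.sum_apply, ContinuousAlternatingMap.smul_apply, hA]

omit [Fintype ι] in
/-- **Every class of `NS_ℝ(X)` is of type `(1,1)`** (`NS_ℝ(X) ⊆ H^{1,1}(X, ℝ)`). [cite: Lange2023AbelianVarietiesComplex, §1.3.1 (NS(X) as hermitian forms)] -/
theorem type_one_one_of_mem_span_isNSForm {θ : E [⋀^Fin 2]→L[ℝ] ℝ}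
    (hθ : θ ∈ Submodule.span ℝ {η : E [⋀^Fin 2]→L[ℝ] ℝ | IsNSForm Φ η}) (u v : E) :
    θ ![I • u, I • v] = θ ![u, v] := by
  induction hθ using Submodule.span_induction with
  | mem η hη => exact hη.type_one_one u v
  | zero => rfl
  | add θ₁ θ₂ _ _ ih₁ ih₂ => simp only [ContinuousAlternatingMap.add_apply, ih₁, ih₂]
  | smul r θ _ ih => simp only [ContinuousAlternatingMap.smul_apply, ih]

end Span

/-! ### §2 A nef class of `NS_ℝ(X)` is positive semi-definite -/

section Real

variable {ι : Type*} [Fintype ι] [DecidableEq ι] {E : Type u} [NormedAddCommGroup E] [InnerProductSpace ℂ E]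
  [FiniteDimensional ℂ E] [MeasurableSpace E] [BorelSpace E] (Φ : (ι → ℝ) ≃L[ℝ] E) {g : ℕ}

omit [Fintype ι] [DecidableEq ι] [FiniteDimensional ℂ E] [MeasurableSpace E] [BorelSpace E] in
/-- `ofRealForm (-(c • θ)) = c • ofRealForm (-θ)` for a real scalar `c`. [folklore] -/
private theorem ofRealForm_neg_smul₅₀ (c : ℝ) (θ : E [⋀^Fin 2]→L[ℝ] ℝ) :
    ofRealForm (-(c • θ)) = (c : ℂ) • ofRealForm (-θ) := by
  ext v
  simp only [ofRealForm_apply, ContinuousAlternatingMap.neg_apply, ContinuousAlternatingMap.smul_apply,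
    smul_eq_mul]
  push_cast
  ring

omit [Fintype ι] [DecidableEq ι] [FiniteDimensional ℂ E] [MeasurableSpace E] [BorelSpace E] in
/-- `ofRealForm (-(Σ cᵢ Aᵢ)) = Σ cᵢ ofRealForm (-Aᵢ)`. [folklore] -/
private theorem ofRealForm_neg_sum_smul {n : ℕ} (c : Fin n → ℝ) (A : Fin n → E [⋀^Fin 2]→L[ℝ] ℝ) :
    ofRealForm (-(∑ i, c i • A i)) = ∑ i, (c i : ℂ) • ofRealForm (-(A i)) := by
  ext v
  simp only [ofRealForm_apply, ContinuousAlternatingMap.neg_apply, ContinuousAlternatingMap.sum_apply,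
    ContinuousAlternatingMap.smul_apply, smul_eq_mul]
  push_cast
  rw [← Finset.sum_neg_distrib]
  refine Finset.sum_congr rfl fun i _ ↦ ?_
  ring

/-- **THE NEF CONE OF `NS_ℝ(X)` IS THE SEMI-POSITIVE CONE (Bauer 1998, §4, for real classes): on a complex
abelian variety, a class `θ ∈ NS_ℝ(X) = NS(X) ⊗ ℝ` with `∫_C ofRealForm(-θ) ≥ 0` for every irreducible curve
`C` has `H_θ ≥ 0`.** Reduction to the integral case (file 48): `θ = Σ cᵢ Aᵢ` with polarisations `Aᵢ` (§1);
for `b ∈ ℕ` and `aᵢ = ⌊b cᵢ⌋ + 1` the class `ψ = Σ aᵢ Aᵢ = bθ + Σ (aᵢ - b cᵢ) Aᵢ ∈ NS(X)` is nef, hence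
`H_ψ ≥ 0` (`IsAbelianVariety.semipos_of_forall_curve_re_analyticCyclePeriod_nonneg`), and
`0 < aᵢ - b cᵢ ≤ 1` gives `b H_θ(v, v) ≥ -Σ H_{Aᵢ}(v, v)` for every `b ≥ 1`.
[cite: Bauer1998ConeOfCurves, §4 (the nef cone `Nef(X) ⊆ NS_ℝ(X)` "coincides with the effective cone") and §2 Lemma 2.1]
[cite: Debarre2001, §1.12 Exercise 7] -/
theorem IsAbelianVariety.semipos_of_mem_span_isNSForm_of_forall_curve_nonneg (hX : IsAbelianVariety Φ)
    (e : Fin (2 * g) ≃ ι) {θ : E [⋀^Fin 2]→L[ℝ] ℝ}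
    (hθ : θ ∈ Submodule.span ℝ {η : E [⋀^Fin 2]→L[ℝ] ℝ | IsNSForm Φ η})
    (hnef : ∀ (C : Set (ComplexTorus Φ)) (hC : HasPureDim 𝓘(ℂ, E) C 1), IsIrreducibleAnalyticSet 𝓘(ℂ, E) C →
      0 ≤ (analyticCyclePeriod Φ hC (ofRealForm (-θ))).re) (v : E) :
    0 ≤ θ ![I • v, v] := by
  obtain ⟨n, c, A, hA, rfl⟩ := hX.exists_sum_smul_isRiemannForm_of_mem_span Φ hθ
  -- `S = Σ H_{Aᵢ}(v, v) ≥ 0`; claim `b · H_θ(v,v) ≥ -S` for every `b ∈ ℕ`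
  set S : ℝ := ∑ i, A i ![I • v, v] with hS
  have hbound : ∀ b : ℕ, -S ≤ (b : ℝ) * (∑ i, c i • A i) ![I • v, v] := by
    intro b
    -- the integral class `ψ = Σ aᵢ Aᵢ`, `aᵢ = ⌊b cᵢ⌋ + 1`
    set a : Fin n → ℤ := fun i ↦ ⌊(b : ℝ) * c i⌋ + 1 with ha
    have ha_pos : ∀ i, 0 < (a i : ℝ) - b * c i := fun i ↦ by
      have h := Int.lt_floor_add_one ((b : ℝ) * c i)
      simp only [ha, Int.cast_add, Int.cast_one]
      linarith
    have ha_le : ∀ i, (a i : ℝ) - b * c i ≤ 1 := fun i ↦ by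
      have h := Int.floor_le ((b : ℝ) * c i)
      simp only [ha, Int.cast_add, Int.cast_one]
      linarith
    set ψ : E [⋀^Fin 2]→L[ℝ] ℝ := ∑ i, (a i : ℝ) • A i with hψ
    have hψNS : IsNSForm Φ ψ := by
      refine (mem_neronSeveriGroup_iff Φ).1 (AddSubgroup.sum_mem _ fun i _ ↦ ?_)
      have h := AddSubgroup.zsmul_mem _ ((mem_neronSeveriGroup_iff Φ).2 (hA i).isNSForm) (a i)
      convert h using 1
      exact Int.cast_smul_eq_zsmul ℝ (a i) (A i)
    have hψeq : ψ = (b : ℝ) • (∑ i, c i • A i) + ∑ i, ((a i : ℝ) - b * c i) • A i := by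
      rw [hψ, Finset.smul_sum, ← Finset.sum_add_distrib]
      refine Finset.sum_congr rfl fun i _ ↦ ?_
      rw [smul_smul, ← add_smul]
      congr 1
      ring
    -- `ψ` is nef
    have hψnef : ∀ (C : Set (ComplexTorus Φ)) (hC : HasPureDim 𝓘(ℂ, E) C 1), IsIrreducibleAnalyticSet 𝓘(ℂ, E) C →
        0 ≤ (analyticCyclePeriod Φ hC (ofRealForm (-ψ))).re := by
      intro C hC hCi
      have hdec : ofRealForm (-ψ) = ((b : ℝ) : ℂ) • ofRealForm (-(∑ i, c i • A i)) +
          ∑ i, (((a i : ℝ) - b * c i : ℝ) : ℂ) • ofRealForm (-(A i)) := by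
        rw [hψeq, neg_add, ofRealForm_add, ofRealForm_neg_smul₅₀, ofRealForm_neg_sum_smul, ofRealForm_neg_sum_smul]
      rw [hdec, map_add, map_smul, map_sum, Complex.add_re, smul_eq_mul, Complex.re_ofReal_mul, Complex.re_sum]
      refine add_nonneg (mul_nonneg b.cast_nonneg (hnef C hC hCi)) (Finset.sum_nonneg fun i _ ↦ ?_)
      rw [map_smul, smul_eq_mul, Complex.re_ofReal_mul]
      exact mul_nonneg (ha_pos i).le
        (re_analyticCyclePeriod_ofRealForm_neg_nonneg_of_semipos Φ (hA i).1
          (apply_I_smul_self_nonneg_of_pos (hA i).2.2) hC)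
    -- hence semi-positive
    have hψpsd := hX.semipos_of_forall_curve_re_analyticCyclePeriod_nonneg Φ e hψNS hψnef v
    rw [hψeq, ContinuousAlternatingMap.add_apply, ContinuousAlternatingMap.smul_apply, smul_eq_mul] at hψpsd
    have hsum : (∑ i, ((a i : ℝ) - b * c i) • A i) ![I • v, v] ≤ S := by
      rw [hS, ContinuousAlternatingMap.sum_apply]
      refine Finset.sum_le_sum fun i _ ↦ ?_
      rw [ContinuousAlternatingMap.smul_apply, smul_eq_mul]
      have hAi := apply_I_smul_self_nonneg_of_pos (hA i).2.2 v
      nlinarith [ha_le i, ha_pos i]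
    linarith
  -- let `b → ∞`
  by_contra hneg
  push Not at hneg
  have hS0 : 0 ≤ S := Finset.sum_nonneg fun i _ ↦ apply_I_smul_self_nonneg_of_pos (hA i).2.2 v
  obtain ⟨b, hb⟩ := exists_nat_gt (S / (-(∑ i, c i • A i) ![I • v, v]))
  have h := hbound b
  rw [div_lt_iff₀ (neg_pos.2 hneg)] at hb
  nlinarith

/-- **Nef ⟺ positive semi-definite, for real Néron–Severi classes** (the nef cone of `NS_ℝ(X)` of an
abelian variety is `{θ | H_θ ≥ 0}`; `⇒` any real `(1,1)`-form, de Cataldo Thm. 6.1.4).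
[cite: Bauer1998ConeOfCurves, §4 and §2 Lemma 2.1] [cite: Debarre2001, §1.12 Exercise 7] -/
theorem IsAbelianVariety.semipos_iff_forall_curve_of_mem_span (hX : IsAbelianVariety Φ) (e : Fin (2 * g) ≃ ι)
    {θ : E [⋀^Fin 2]→L[ℝ] ℝ} (hθ : θ ∈ Submodule.span ℝ {η : E [⋀^Fin 2]→L[ℝ] ℝ | IsNSForm Φ η}) :
    (∀ v : E, 0 ≤ θ ![I • v, v]) ↔
      ∀ (C : Set (ComplexTorus Φ)) (hC : HasPureDim 𝓘(ℂ, E) C 1), IsIrreducibleAnalyticSet 𝓘(ℂ, E) C →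
        0 ≤ (analyticCyclePeriod Φ hC (ofRealForm (-θ))).re :=
  ⟨fun h _ hC _ ↦ re_analyticCyclePeriod_ofRealForm_neg_nonneg_of_semipos Φ
      (type_one_one_of_mem_span_isNSForm Φ hθ) h hC,
    fun h ↦ hX.semipos_of_mem_span_isNSForm_of_forall_curve_nonneg Φ e hθ h⟩

/-- **The ample cone is dense in the nef cone: `θ + εA > 0` for nef `θ ∈ NS_ℝ(X)`, a polarisation `A` and
every `ε > 0`** (nef ⇒ `H_θ ≥ 0`, plus `εH_A > 0`); conversely a limit of positive forms is semi-positive —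
the nef cone of an abelian variety is the closure of its ample cone. [cite: Bauer1998ConeOfCurves, §4 and §2 Lemma 2.1 (proof: "`A + mL` is ample")] -/
theorem IsAbelianVariety.forall_pos_add_smul_of_forall_curve_nonneg (hX : IsAbelianVariety Φ)
    (e : Fin (2 * g) ≃ ι) {θ A : E [⋀^Fin 2]→L[ℝ] ℝ}
    (hθ : θ ∈ Submodule.span ℝ {η : E [⋀^Fin 2]→L[ℝ] ℝ | IsNSForm Φ η})
    (hnef : ∀ (C : Set (ComplexTorus Φ)) (hC : HasPureDim 𝓘(ℂ, E) C 1), IsIrreducibleAnalyticSet 𝓘(ℂ, E) C →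
      0 ≤ (analyticCyclePeriod Φ hC (ofRealForm (-θ))).re)
    (hA : IsRiemannForm Φ A) {ε : ℝ} (hε : 0 < ε) (v : E) (hv : v ≠ 0) :
    0 < (θ + ε • A) ![I • v, v] := by
  rw [ContinuousAlternatingMap.add_apply, ContinuousAlternatingMap.smul_apply, smul_eq_mul]
  exact add_pos_of_nonneg_of_pos (hX.semipos_of_mem_span_isNSForm_of_forall_curve_nonneg Φ e hθ hnef v)
    (mul_pos hε (hA.2.2 v hv))

/-- **Kleiman's theorem for real classes on an abelian variety: nef classes of `NS_ℝ(X)` integrate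
non-negatively on every subvariety** — for nef `θ₁, …, θ_d ∈ NS_ℝ(X)` and a closed analytic `Z ⊆ X` of pure
dimension `d`, `Re ∫_Z ofRealForm(-θ₁) ∧ ⋯ ∧ ofRealForm(-θ_d) ≥ 0`. [cite: Bauer1998ConeOfCurves, §4 and §2 Lemma 2.1 ((ii) ⇒ (iii))]
[cite: Decataldo2007, Thm. 6.1.4] -/
theorem IsAbelianVariety.re_analyticCyclePeriod_wedgeFamily_nonneg_of_mem_span_of_forall_curve
    (hX : IsAbelianVariety Φ) (e : Fin (2 * g) ≃ ι) {d : ℕ} {θ : Fin d → E [⋀^Fin 2]→L[ℝ] ℝ}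
    (hθ : ∀ j, θ j ∈ Submodule.span ℝ {η : E [⋀^Fin 2]→L[ℝ] ℝ | IsNSForm Φ η})
    (hnef : ∀ j (C : Set (ComplexTorus Φ)) (hC : HasPureDim 𝓘(ℂ, E) C 1), IsIrreducibleAnalyticSet 𝓘(ℂ, E) C →
      0 ≤ (analyticCyclePeriod Φ hC (ofRealForm (-(θ j)))).re)
    {Z : Set (ComplexTorus Φ)} (hZ : HasPureDim 𝓘(ℂ, E) Z d) :
    0 ≤ (analyticCyclePeriod Φ hZ (wedgeFamily d fun j ↦ ofRealForm (-(θ j)))).re :=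
  analyticCyclePeriod_wedgeFamily_nonneg_of_semipos Φ hZ θ (fun j ↦ type_one_one_of_mem_span_isNSForm Φ (hθ j))
    fun j ↦ hX.semipos_of_mem_span_isNSForm_of_forall_curve_nonneg Φ e (hθ j) (hnef j)

/-- **Mixed intersection numbers of nef real classes are `≥ 0`**: for nef `θ₁, …, θ_g ∈ NS_ℝ(X)` on an abelian
variety of dimension `g`, `∫_X ofRealForm(-θ₁) ∧ ⋯ ∧ ofRealForm(-θ_g) ≥ 0` (Bauer (ii) ⇒ (iii) for real
classes). [cite: Bauer1998ConeOfCurves, §2 Lemma 2.1 ((ii) ⇒ (iii)) and §4] [cite: Lange2023AbelianVarietiesComplex, §2.2.5 Exercise (2)] -/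
theorem IsAbelianVariety.torusIntegral_wedgeFamily_nonneg_of_mem_span_of_forall_curve (hX : IsAbelianVariety Φ)
    (e : Fin (2 * g) ≃ ι) {θ : Fin g → E [⋀^Fin 2]→L[ℝ] ℝ}
    (hθ : ∀ j, θ j ∈ Submodule.span ℝ {η : E [⋀^Fin 2]→L[ℝ] ℝ | IsNSForm Φ η})
    (hnef : ∀ j (C : Set (ComplexTorus Φ)) (hC : HasPureDim 𝓘(ℂ, E) C 1), IsIrreducibleAnalyticSet 𝓘(ℂ, E) C →
      0 ≤ (analyticCyclePeriod Φ hC (ofRealForm (-(θ j)))).re) :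
    0 ≤ torusIntegral Φ e (wedgeFamily g fun j ↦ ofRealForm (-(θ j))) :=
  torusIntegral_wedgeFamily_nonneg_of_semipos Φ e θ (fun j ↦ type_one_one_of_mem_span_isNSForm Φ (hθ j))
    fun j ↦ hX.semipos_of_mem_span_isNSForm_of_forall_curve_nonneg Φ e (hθ j) (hnef j)

/-! ### §3 `NS_ℝ(X) ↪ N¹(X)_ℝ`: numerical and homological equivalence coincide for real divisor classes; the
nef cone is salient and is the closure of the ample cone -/

/-- **The nef cone of an abelian variety is salient, `Nef(X) ∩ -Nef(X) = {0}` in `NS_ℝ(X)`**: a class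
`θ ∈ NS_ℝ(X)` with `θ` and `-θ` both nef is `0` (both `H_θ ≥ 0` and `H_{-θ} ≥ 0`, so `H_θ = 0`, and an
invariant real `(1,1)`-form is determined by its hermitian form). [cite: Bauer1998ConeOfCurves, §4 ("through the intersection product the vector space `N_1(X)` is dual to the Néron-Severi vector space `NS_ℝ(X)`")]
[cite: Lange2023AbelianVarietiesComplex, §4.6.3 Thm. 4.6.14 (b)] -/
theorem IsAbelianVariety.eq_zero_of_mem_span_isNSForm_of_forall_curve_nonneg_of_neg (hX : IsAbelianVariety Φ)
    (e : Fin (2 * g) ≃ ι) {θ : E [⋀^Fin 2]→L[ℝ] ℝ}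
    (hθ : θ ∈ Submodule.span ℝ {η : E [⋀^Fin 2]→L[ℝ] ℝ | IsNSForm Φ η})
    (hpos : ∀ (C : Set (ComplexTorus Φ)) (hC : HasPureDim 𝓘(ℂ, E) C 1), IsIrreducibleAnalyticSet 𝓘(ℂ, E) C →
      0 ≤ (analyticCyclePeriod Φ hC (ofRealForm (-θ))).re)
    (hneg : ∀ (C : Set (ComplexTorus Φ)) (hC : HasPureDim 𝓘(ℂ, E) C 1), IsIrreducibleAnalyticSet 𝓘(ℂ, E) C →
      0 ≤ (analyticCyclePeriod Φ hC (ofRealForm θ)).re) :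
    θ = 0 := by
  have h11 := type_one_one_of_mem_span_isNSForm Φ hθ
  have hpsd := hX.semipos_of_mem_span_isNSForm_of_forall_curve_nonneg Φ e hθ hpos
  have hnsd := hX.semipos_of_mem_span_isNSForm_of_forall_curve_nonneg Φ e (Submodule.neg_mem _ hθ)
    (fun C hC hCi ↦ by rw [neg_neg]; exact hneg C hC hCi)
  refine twoForm_eq_of_forall_apply_I_smul_self h11
    (fun _ _ ↦ by simp only [ContinuousAlternatingMap.coe_zero, Pi.zero_apply]) fun v ↦ ?_
  rw [ContinuousAlternatingMap.coe_zero, Pi.zero_apply]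
  have h := hnsd v
  rw [ContinuousAlternatingMap.neg_apply] at h
  exact le_antisymm (neg_nonneg.1 h) (hpsd v)

/-- **Numerical and homological equivalence coincide for real divisor classes of an abelian variety**
(Matsusaka's theorem with real coefficients: `NS_ℝ(X) → N¹(X)_ℝ = Hom(N_1(X), ℝ)` is injective, "the vector
space `N_1(X)` is dual to `NS_ℝ(X)`"): a class `θ ∈ NS_ℝ(X)` with `Re ∫_C θ = 0` for every irreducible curve `C`
is `0`. [cite: Bauer1998ConeOfCurves, §4] [cite: Lange2023AbelianVarietiesComplex, §4.6.3 Thm. 4.6.14 (b)]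
[cite: Fulton1998, §19.3 Example 19.3.3] -/
theorem IsAbelianVariety.eq_zero_of_mem_span_isNSForm_of_forall_curve_re_eq_zero (hX : IsAbelianVariety Φ)
    (e : Fin (2 * g) ≃ ι) {θ : E [⋀^Fin 2]→L[ℝ] ℝ}
    (hθ : θ ∈ Submodule.span ℝ {η : E [⋀^Fin 2]→L[ℝ] ℝ | IsNSForm Φ η})
    (h0 : ∀ (C : Set (ComplexTorus Φ)) (hC : HasPureDim 𝓘(ℂ, E) C 1), IsIrreducibleAnalyticSet 𝓘(ℂ, E) C →
      (analyticCyclePeriod Φ hC (ofRealForm θ)).re = 0) :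
    θ = 0 :=
  hX.eq_zero_of_mem_span_isNSForm_of_forall_curve_nonneg_of_neg Φ e hθ
    (fun C hC hCi ↦ by rw [ofRealForm_neg, map_neg, Complex.neg_re, h0 C hC hCi, neg_zero])
    fun C hC hCi ↦ (h0 C hC hCi).ge

/-- The same with complex periods `∫_C θ = 0`. [cite: Bauer1998ConeOfCurves, §4]
[cite: Lange2023AbelianVarietiesComplex, §4.6.3 Thm. 4.6.14 (b)] [cite: Fulton1998, §19.3 Example 19.3.3] -/
theorem IsAbelianVariety.eq_zero_of_mem_span_isNSForm_of_forall_curve_eq_zero (hX : IsAbelianVariety Φ)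
    (e : Fin (2 * g) ≃ ι) {θ : E [⋀^Fin 2]→L[ℝ] ℝ}
    (hθ : θ ∈ Submodule.span ℝ {η : E [⋀^Fin 2]→L[ℝ] ℝ | IsNSForm Φ η})
    (h0 : ∀ (C : Set (ComplexTorus Φ)) (hC : HasPureDim 𝓘(ℂ, E) C 1), IsIrreducibleAnalyticSet 𝓘(ℂ, E) C →
      analyticCyclePeriod Φ hC (ofRealForm θ) = 0) :
    θ = 0 :=
  hX.eq_zero_of_mem_span_isNSForm_of_forall_curve_re_eq_zero Φ e hθ fun C hC hCi ↦ by
    rw [h0 C hC hCi, Complex.zero_re]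

/-- **Two classes of `NS_ℝ(X)` with the same degree on every irreducible curve are equal** (`NS_ℝ(X)` IS the
real numerical divisor class space `N¹(X)_ℝ` of an abelian variety). [cite: Bauer1998ConeOfCurves, §4]
[cite: Lange2023AbelianVarietiesComplex, §4.6.3 Thm. 4.6.14 (b)] [cite: KollarMori1998, §1.4 Def. 1.16 and Def. 1.17 (`N_1(X)`, `NE(X)`)] -/
theorem IsAbelianVariety.eq_iff_forall_curve_of_mem_span_isNSForm (hX : IsAbelianVariety Φ) (e : Fin (2 * g) ≃ ι)
    {θ₁ θ₂ : E [⋀^Fin 2]→L[ℝ] ℝ} (hθ₁ : θ₁ ∈ Submodule.span ℝ {η : E [⋀^Fin 2]→L[ℝ] ℝ | IsNSForm Φ η})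
    (hθ₂ : θ₂ ∈ Submodule.span ℝ {η : E [⋀^Fin 2]→L[ℝ] ℝ | IsNSForm Φ η}) :
    θ₁ = θ₂ ↔ ∀ (C : Set (ComplexTorus Φ)) (hC : HasPureDim 𝓘(ℂ, E) C 1), IsIrreducibleAnalyticSet 𝓘(ℂ, E) C →
      analyticCyclePeriod Φ hC (ofRealForm θ₁) = analyticCyclePeriod Φ hC (ofRealForm θ₂) := by
  refine ⟨fun h _ _ _ ↦ by rw [h], fun h ↦ ?_⟩
  rw [← sub_eq_zero]
  refine hX.eq_zero_of_mem_span_isNSForm_of_forall_curve_eq_zero Φ e (Submodule.sub_mem _ hθ₁ hθ₂)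
    fun C hC hCi ↦ ?_
  rw [sub_eq_add_neg, ofRealForm_add, ofRealForm_neg, map_add, map_neg, h C hC hCi, add_neg_cancel]

/-- **The nef cone is the closure of the ample cone**: for `θ ∈ NS_ℝ(X)` and a polarisation `A` of an abelian
variety, `θ` is nef iff `θ + εA > 0` for every `ε > 0` ("the ample cone, whose closure is the nef cone";
"for all `t > 0`, the ℝ-divisor `D + tH` is positive"). [cite: Debarre2001, §1.7 (the ample cone and its closure) and 1.28 (nef ℝ-divisors)]
[cite: Bauer1998ConeOfCurves, §4 and §2 Lemma 2.1 (proof: "`A + mL` is ample")] -/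
theorem IsAbelianVariety.forall_curve_nonneg_iff_forall_pos_add_smul_pos (hX : IsAbelianVariety Φ)
    (e : Fin (2 * g) ≃ ι) {θ A : E [⋀^Fin 2]→L[ℝ] ℝ}
    (hθ : θ ∈ Submodule.span ℝ {η : E [⋀^Fin 2]→L[ℝ] ℝ | IsNSForm Φ η}) (hA : IsRiemannForm Φ A) :
    (∀ (C : Set (ComplexTorus Φ)) (hC : HasPureDim 𝓘(ℂ, E) C 1), IsIrreducibleAnalyticSet 𝓘(ℂ, E) C →
      0 ≤ (analyticCyclePeriod Φ hC (ofRealForm (-θ))).re) ↔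
      ∀ ε : ℝ, 0 < ε → ∀ v : E, v ≠ 0 → 0 < (θ + ε • A) ![I • v, v] := by
  refine ⟨fun h ε hε v hv ↦ hX.forall_pos_add_smul_of_forall_curve_nonneg Φ e hθ h hA hε v hv, fun h ↦ ?_⟩
  refine (hX.semipos_iff_forall_curve_of_mem_span Φ e hθ).1 fun v ↦ ?_
  have hAv : 0 ≤ A ![I • v, v] := apply_I_smul_self_nonneg_of_pos hA.2.2 v
  refine le_of_forall_pos_le_add fun ε hε ↦ ?_
  have hε' : 0 < ε / (A ![I • v, v] + 1) := div_pos hε (by linarith)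
  have h1 := apply_I_smul_self_nonneg_of_pos (h _ hε') v
  rw [ContinuousAlternatingMap.add_apply, ContinuousAlternatingMap.smul_apply, smul_eq_mul] at h1
  have h2 : ε / (A ![I • v, v] + 1) * A ![I • v, v] ≤ ε := by
    rw [div_mul_eq_mul_div, div_le_iff₀ (by linarith)]
    nlinarith
  linarith

end Real

/-! ### §4 Nef and big real classes are ample -/

section Big

variable {ι : Type*} [Fintype ι] [DecidableEq ι] {E : Type u} [NormedAddCommGroup E] [InnerProductSpace ℂ E]
  [FiniteDimensional ℂ E] [MeasurableSpace E] [BorelSpace E] (Φ : (ι → ℝ) ≃L[ℝ] E) {g : ℕ}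

omit [FiniteDimensional ℂ E] [MeasurableSpace E] [BorelSpace E] in
/-- **`(θ^g) = 0` for a semi-positive real `(1,1)`-form with an isotropic vector**: if `H_θ ≥ 0` and
`H_θ(u₀, u₀) = 0` for some `u₀ ≠ 0`, then `u₀` lies in the radical of `θ` (Cauchy–Schwarz,
`apply_eq_zero_of_self_eq_zero`), so `(-θ)^{∧g} = 0` (`wedgePow_ofRealForm_eq_zero_of_degenerate`) and
`∫_X (-θ)^{∧g} = 0` — the real-coefficient form of `IsNSForm.torusIntegral_wedgePow_neg_eq_zero_of_semipos_of_not_pos`.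
[cite: Lange2023AbelianVarietiesComplex, §1.7.2 proof of Thm. 1.7.3 and §2.1.3 Prop. 2.1.11 ((iv) ⇒ (ii))] -/
theorem torusIntegral_wedgePow_neg_eq_zero_of_semipos_of_apply_I_smul_self_eq_zero (e : Fin (2 * g) ≃ ι)
    {θ : E [⋀^Fin 2]→L[ℝ] ℝ} (h11 : ∀ u v : E, θ ![I • u, I • v] = θ ![u, v])
    (hpsd : ∀ v : E, 0 ≤ θ ![I • v, v]) {u₀ : E} (hu₀ : u₀ ≠ 0) (h0 : θ ![I • u₀, u₀] = 0) :
    torusIntegral Φ e (wedgePow (ofRealForm (-θ)) g) = 0 := by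
  have hker : ∀ x : E, (-θ) ![u₀, x] = 0 := fun x ↦ by
    rw [ContinuousAlternatingMap.neg_apply, neg_eq_zero]
    exact apply_eq_zero_of_self_eq_zero h11 hpsd h0 x
  rw [wedgePow_ofRealForm_eq_zero_of_degenerate Φ e (-θ) hu₀ hker, torusIntegral_zero]

/-- **Nef and big real classes of an abelian variety are ample**: a nef `θ ∈ NS_ℝ(X)` with
`(θ^g) = ∫_X (-θ)^{∧g} ≠ 0` has `H_θ > 0` (nef ⇒ `H_θ ≥ 0` by §2; an isotropic vector would force
`(θ^g) = 0`). [cite: Debarre2001, 1.29 (nef and big divisors)] [cite: Bauer1998ConeOfCurves, §2 Lemma 2.1]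
[cite: Lange2023AbelianVarietiesComplex, §2.1.3 Prop. 2.1.11 ((iv) ⇒ (ii))] -/
theorem IsAbelianVariety.forall_pos_of_mem_span_of_forall_curve_nonneg_of_torusIntegral_wedgePow_ne_zero
    (hX : IsAbelianVariety Φ) (e : Fin (2 * g) ≃ ι) {θ : E [⋀^Fin 2]→L[ℝ] ℝ}
    (hθ : θ ∈ Submodule.span ℝ {η : E [⋀^Fin 2]→L[ℝ] ℝ | IsNSForm Φ η})
    (hnef : ∀ (C : Set (ComplexTorus Φ)) (hC : HasPureDim 𝓘(ℂ, E) C 1), IsIrreducibleAnalyticSet 𝓘(ℂ, E) C →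
      0 ≤ (analyticCyclePeriod Φ hC (ofRealForm (-θ))).re)
    (hbig : torusIntegral Φ e (wedgePow (ofRealForm (-θ)) g) ≠ 0) (v : E) (hv : v ≠ 0) :
    0 < θ ![I • v, v] := by
  have hpsd := hX.semipos_of_mem_span_isNSForm_of_forall_curve_nonneg Φ e hθ hnef
  refine (hpsd v).lt_of_ne fun h0 ↦ hbig ?_
  exact torusIntegral_wedgePow_neg_eq_zero_of_semipos_of_apply_I_smul_self_eq_zero Φ e
    (type_one_one_of_mem_span_isNSForm Φ hθ) hpsd hv h0.symm

/-- **For a nef real class, ample ⟺ big**: a nef `θ ∈ NS_ℝ(X)` has `H_θ > 0` iff `(θ^g) ≠ 0` (`⇒`: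
`(θ^g) > 0` for positive `θ`, Lange Lemma 2.2.2). [cite: Debarre2001, 1.29 (nef and big divisors)]
[cite: Lange2023AbelianVarietiesComplex, §2.2.1 Lemma 2.2.2 and §2.1.3 Prop. 2.1.11] -/
theorem IsAbelianVariety.forall_pos_iff_torusIntegral_wedgePow_ne_zero_of_forall_curve_nonneg
    (hX : IsAbelianVariety Φ) (e : Fin (2 * g) ≃ ι) {θ : E [⋀^Fin 2]→L[ℝ] ℝ}
    (hθ : θ ∈ Submodule.span ℝ {η : E [⋀^Fin 2]→L[ℝ] ℝ | IsNSForm Φ η})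
    (hnef : ∀ (C : Set (ComplexTorus Φ)) (hC : HasPureDim 𝓘(ℂ, E) C 1), IsIrreducibleAnalyticSet 𝓘(ℂ, E) C →
      0 ≤ (analyticCyclePeriod Φ hC (ofRealForm (-θ))).re) :
    (∀ v : E, v ≠ 0 → 0 < θ ![I • v, v]) ↔ torusIntegral Φ e (wedgePow (ofRealForm (-θ)) g) ≠ 0 := by
  refine ⟨fun hpos ↦ ?_, fun hbig v hv ↦
    hX.forall_pos_of_mem_span_of_forall_curve_nonneg_of_torusIntegral_wedgePow_ne_zero Φ e hθ hnef hbig v hv⟩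
  have h := torusIntegral_wedgeFamily_pos_of_pos Φ e (fun _ : Fin g ↦ θ)
    (fun _ ↦ type_one_one_of_mem_span_isNSForm Φ hθ) (fun _ ↦ hpos)
  rw [wedgePow]
  exact h.ne'

end Big

/-! ### §5 Bauer's nef threshold `s = inf {t ∈ ℝ | tL₁ - L₂ is nef}` as printed: `[s, ∞)` is the set of nef
`tL₁ - L₂`, `s > 0`, and `s ∉ ℚ` on a simple abelian variety -/

section Threshold

variable {ι : Type*} [Fintype ι] [DecidableEq ι] {E : Type u} [NormedAddCommGroup E] [InnerProductSpace ℂ E]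
  [FiniteDimensional ℂ E] [MeasurableSpace E] [BorelSpace E] (Φ : (ι → ℝ) ≃L[ℝ] E) {g : ℕ}

omit [Fintype ι] [DecidableEq ι] [FiniteDimensional ℂ E] [MeasurableSpace E] [BorelSpace E] in
/-- `ofRealForm (-(tL₁ - L₂)) = t • ofRealForm (-L₁) - ofRealForm (-L₂)`. [folklore] -/
private theorem ofRealForm_neg_smul_sub (t : ℝ) (L₁ L₂ : E [⋀^Fin 2]→L[ℝ] ℝ) :
    ofRealForm (-(t • L₁ - L₂)) = (t : ℂ) • ofRealForm (-L₁) - ofRealForm (-L₂) := by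
  ext v
  simp only [ofRealForm_apply, ContinuousAlternatingMap.neg_apply, ContinuousAlternatingMap.sub_apply,
    ContinuousAlternatingMap.smul_apply, smul_eq_mul]
  push_cast
  ring

/-- **"`tL₁ - L₂` is nef means that `tL₁C ≥ L₂C` for every irreducible curve `C`"** (Bauer): for an
`ℝ`-line bundle `tL₁ - L₂`, `Re ∫_C c₁(tL₁ - L₂) ≥ 0` for all irreducible curves `C` iff `t·(L₁·C) ≥ (L₂·C)`
for all `C`, iff (on an abelian variety, §2) `H_{tL₁ - L₂} ≥ 0`. [cite: Bauer1998ConeOfCurves, §2 Prop. 2.2 (proof: "nefness means that `tL₁C ≥ L₂C` for every irreducible curve `C`")] -/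
theorem IsAbelianVariety.forall_curve_le_smul_iff_semipos_smul_sub (hX : IsAbelianVariety Φ) (e : Fin (2 * g) ≃ ι)
    {L₁ L₂ : E [⋀^Fin 2]→L[ℝ] ℝ} (h₁ : IsNSForm Φ L₁) (h₂ : IsNSForm Φ L₂) (t : ℝ) :
    (∀ (C : Set (ComplexTorus Φ)) (hC : HasPureDim 𝓘(ℂ, E) C 1), IsIrreducibleAnalyticSet 𝓘(ℂ, E) C →
      (analyticCyclePeriod Φ hC (ofRealForm (-L₂))).re ≤ t * (analyticCyclePeriod Φ hC (ofRealForm (-L₁))).re) ↔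
      ∀ v : E, 0 ≤ (t • L₁ - L₂) ![I • v, v] := by
  have hmem : t • L₁ - L₂ ∈ Submodule.span ℝ {η : E [⋀^Fin 2]→L[ℝ] ℝ | IsNSForm Φ η} :=
    Submodule.sub_mem _ (Submodule.smul_mem _ t (Submodule.subset_span h₁)) (Submodule.subset_span h₂)
  rw [hX.semipos_iff_forall_curve_of_mem_span Φ e hmem]
  refine forall₃_congr fun C hC _ ↦ ?_
  rw [ofRealForm_neg_smul_sub, map_sub, map_smul, Complex.sub_re, smul_eq_mul, Complex.re_ofReal_mul, sub_nonneg]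

/-- **The nef threshold of two ample line bundles (Bauer, proof of Prop. 2.2: "the positive real number
`s = inf {t ∈ ℝ | tL₁ - L₂ is nef}`")**: on an abelian variety `X ≠ 0` the set `T = {t ∈ ℝ | tL₁C ≥ L₂C for
every irreducible curve C}` is the closed half-line `[s, ∞)` with `s = inf T > 0` and `s ∈ T`.
[cite: Bauer1998ConeOfCurves, §2 Prop. 2.2 (proof: "the positive real number `s`")] -/
theorem IsAbelianVariety.setOf_forall_curve_le_smul_eq_Ici [Nontrivial E] (hX : IsAbelianVariety Φ)
    (e : Fin (2 * g) ≃ ι) {L₁ L₂ : E [⋀^Fin 2]→L[ℝ] ℝ} (h₁ : IsRiemannForm Φ L₁) (h₂ : IsRiemannForm Φ L₂) :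
    let T : Set ℝ := {t | ∀ (C : Set (ComplexTorus Φ)) (hC : HasPureDim 𝓘(ℂ, E) C 1),
      IsIrreducibleAnalyticSet 𝓘(ℂ, E) C →
        (analyticCyclePeriod Φ hC (ofRealForm (-L₂))).re ≤ t * (analyticCyclePeriod Φ hC (ofRealForm (-L₁))).re}
    T = Ici (sInf T) ∧ 0 < sInf T ∧ sInf T ∈ T := by
  intro T
  have hT : T = {t | ∀ v : E, 0 ≤ (t • L₁ - L₂) ![I • v, v]} :=
    Set.ext fun t ↦ hX.forall_curve_le_smul_iff_semipos_smul_sub Φ e h₁.isNSForm h₂.isNSForm t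
  rw [hT]
  exact setOf_semipos_smul_sub_eq_Ici h₁.1 h₁.2.2 h₂.1 h₂.2.2

/-- **Bauer 1998, Prop. 2.2, assertion (2.1), AS PRINTED: on a simple abelian variety, for ample line bundles
`L₁`, `L₂` whose classes are not proportional, `s = inf {t ∈ ℝ | tL₁ - L₂ is nef}` — "nefness means that
`tL₁C ≥ L₂C` for every irreducible curve `C`" — is irrational, `s ∉ ℚ`.** (By §2 the nef threshold is the
semi-positivity threshold of `ComplexTorusNefConeSemipositive` §9.) [cite: Bauer1998ConeOfCurves, §2 Prop. 2.2 (proof, assertion (2.1) "`s ∉ ℚ`")] -/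
theorem IsSimple.irrational_sInf_setOf_forall_curve_le_smul (hS : IsSimple Φ) (e : Fin (2 * g) ≃ ι)
    {L₁ L₂ : E [⋀^Fin 2]→L[ℝ] ℝ} (h₁ : IsRiemannForm Φ L₁) (h₂ : IsRiemannForm Φ L₂)
    (hprop : ∀ q : ℚ, (q : ℝ) • L₁ ≠ L₂) :
    Irrational (sInf {t : ℝ | ∀ (C : Set (ComplexTorus Φ)) (hC : HasPureDim 𝓘(ℂ, E) C 1),
      IsIrreducibleAnalyticSet 𝓘(ℂ, E) C →
        (analyticCyclePeriod Φ hC (ofRealForm (-L₂))).re ≤ t * (analyticCyclePeriod Φ hC (ofRealForm (-L₁))).re}) := by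
  have hX : IsAbelianVariety Φ := ⟨L₁, h₁⟩
  have hT : {t : ℝ | ∀ (C : Set (ComplexTorus Φ)) (hC : HasPureDim 𝓘(ℂ, E) C 1), IsIrreducibleAnalyticSet 𝓘(ℂ, E) C →
      (analyticCyclePeriod Φ hC (ofRealForm (-L₂))).re ≤ t * (analyticCyclePeriod Φ hC (ofRealForm (-L₁))).re} =
      {t | ∀ v : E, 0 ≤ (t • L₁ - L₂) ![I • v, v]} :=
    Set.ext fun t ↦ hX.forall_curve_le_smul_iff_semipos_smul_sub Φ e h₁.isNSForm h₂.isNSForm t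
  rw [hT]
  exact hS.irrational_sInf_setOf_semipos_smul_sub Φ h₁ h₂ hprop

end Threshold

/-! ### §6 Abelian surfaces: `Nef(X) = {θ ∈ NS_ℝ(X) | (θ²) ≥ 0, (θ·A) ≥ 0}` (Debarre, 6.3) -/

section Surface

variable {ι : Type*} [Fintype ι] [DecidableEq ι] {E : Type u} [NormedAddCommGroup E] [InnerProductSpace ℂ E]
  [FiniteDimensional ℂ E] [MeasurableSpace E] [BorelSpace E] (Φ : (ι → ℝ) ≃L[ℝ] E)

omit [Fintype ι] [DecidableEq ι] [FiniteDimensional ℂ E] [MeasurableSpace E] [BorelSpace E] in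
/-- `update (update η 0 x) 1 y = ![x, y]` on `Fin 2`. [folklore] -/
private theorem update_update_eq_vecCons (η : Fin 2 → E [⋀^Fin 2]→L[ℝ] ℝ) (x y : E [⋀^Fin 2]→L[ℝ] ℝ) :
    update (update η 0 x) 1 y = ![x, y] := by
  funext j
  fin_cases j
  · simp
  · simp

/-- **The nef cone of an abelian surface** (Debarre, 6.3: for an abelian surface `X` and an ample `H`,
"`NE̅(X) = {z ∈ N_1(X)_ℝ | z² ≥ 0, H·z ≥ 0}`"; on a surface `N_1(X)_ℝ = N¹(X)_ℝ = NS_ℝ(X)` (§3) and the closed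
cone of curves is the nef cone): for a complex abelian surface, a polarisation `A` and `θ ∈ NS_ℝ(X)`,
`θ` is nef iff `(θ²) ≥ 0` and `(θ·A) ≥ 0`. `⇒`: nef ⇒ `H_θ ≥ 0` (§2), and mixed numbers of semi-positive
classes are `≥ 0`. `⇐`: if `H_θ(v, v) < 0` the segment `A + uθ` leaves the positive cone at some `t > 0`
where `A + tθ ≥ 0` has an isotropic vector, so `((A + tθ)²) = 0` (§4); but bilinearity and symmetry of the
intersection form give `((A + tθ)²) = (A²) + 2t(θ·A) + t²(θ²) > 0`.
[cite: Debarre2001, §6 no. 6.3 (the effective cone of an abelian surface)] [cite: Bauer1998ConeOfCurves, §4] -/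
theorem IsAbelianVariety.forall_curve_nonneg_iff_self_nonneg_and_dot_nonneg (hX : IsAbelianVariety Φ)
    (e : Fin (2 * 2) ≃ ι) {θ A : E [⋀^Fin 2]→L[ℝ] ℝ}
    (hθ : θ ∈ Submodule.span ℝ {η : E [⋀^Fin 2]→L[ℝ] ℝ | IsNSForm Φ η}) (hA : IsRiemannForm Φ A) :
    (∀ (C : Set (ComplexTorus Φ)) (hC : HasPureDim 𝓘(ℂ, E) C 1), IsIrreducibleAnalyticSet 𝓘(ℂ, E) C →
      0 ≤ (analyticCyclePeriod Φ hC (ofRealForm (-θ))).re) ↔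
      0 ≤ (torusIntegral Φ e (wedgeFamily 2 fun j ↦ ofRealForm (-(![θ, θ] j)))).re ∧
        0 ≤ (torusIntegral Φ e (wedgeFamily 2 fun j ↦ ofRealForm (-(![θ, A] j)))).re := by
  have h11θ := type_one_one_of_mem_span_isNSForm Φ hθ
  have hpsdA := apply_I_smul_self_nonneg_of_pos hA.2.2
  constructor
  · intro hnef
    have hpsd := hX.semipos_of_mem_span_isNSForm_of_forall_curve_nonneg Φ e hθ hnef
    refine ⟨torusIntegral_wedgeFamily_re_nonneg_of_semipos Φ e _ (fun j ↦ ?_) (fun j ↦ ?_),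
      torusIntegral_wedgeFamily_re_nonneg_of_semipos Φ e _ (fun j ↦ ?_) (fun j ↦ ?_)⟩
    · fin_cases j <;> exact h11θ
    · fin_cases j <;> exact hpsd
    · fin_cases j
      · exact h11θ
      · exact hA.1
    · fin_cases j
      · exact hpsd
      · exact hpsdA
  · rintro ⟨hself, hdot⟩
    by_contra hnef
    obtain ⟨v₀, hv₀⟩ : ∃ v : E, θ ![I • v, v] < 0 := by
      by_contra h
      push Not at h
      exact hnef ((hX.semipos_iff_forall_curve_of_mem_span Φ e hθ).1 h)
    obtain ⟨t, ht, -, hpsd, w, hw, hw0⟩ := exists_pos_endpoint_add_smul hA.1 hA.2.2 h11θ hv₀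
    -- `((A + tθ)²) = 0`
    have h11t : ∀ u v : E, (A + t • θ) ![I • u, I • v] = (A + t • θ) ![u, v] := fun u v ↦ by
      simp only [ContinuousAlternatingMap.add_apply, ContinuousAlternatingMap.smul_apply, hA.1 u v, h11θ u v]
    have hzero :=
      torusIntegral_wedgePow_neg_eq_zero_of_semipos_of_apply_I_smul_self_eq_zero Φ e h11t hpsd hw hw0
    -- the intersection form `Q(x, y) = Re ∫_X (-x) ∧ (-y)`
    set Q := mixedIntersectionForm Φ e ![θ, A] (show (0 : Fin 2) ≠ 1 from Fin.zero_ne_one) with hQdef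
    have hQ : ∀ x y : E [⋀^Fin 2]→L[ℝ] ℝ,
        Q x y = (torusIntegral Φ e (wedgeFamily 2 fun j ↦ ofRealForm (-(![x, y] j)))).re := fun x y ↦ by
      rw [hQdef, mixedIntersectionForm_apply, update_update_eq_vecCons]
    have hQAA : 0 < Q A A := by
      rw [hQ]
      refine torusIntegral_wedgeFamily_re_pos_of_pos Φ e ![A, A] (fun j ↦ ?_) (fun j ↦ ?_)
      · fin_cases j <;> exact hA.1
      · fin_cases j <;> exact hA.2.2
    have hQθθ : 0 ≤ Q θ θ := by rw [hQ]; exact hself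
    have hQθA : 0 ≤ Q θ A := by rw [hQ]; exact hdot
    have hQAθ : 0 ≤ Q A θ := by
      rw [hQdef, mixedIntersectionForm_comm Φ e (fun j hj₀ hj₁ ↦ by fin_cases j <;> simp_all) _
        (mem_realOneOneForms_of_I_smul hA.1) (mem_realOneOneForms_of_I_smul h11θ)]
      exact hQθA
    have h1 : ∀ x y z : E [⋀^Fin 2]→L[ℝ] ℝ, Q (x + y) z = Q x z + Q y z := fun x y z ↦
      LinearMap.BilinForm.add_left x y z
    have h2 : ∀ x y z : E [⋀^Fin 2]→L[ℝ] ℝ, Q x (y + z) = Q x y + Q x z := fun x y z ↦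
      LinearMap.BilinForm.add_right x y z
    have h3 : ∀ (c : ℝ) (x y : E [⋀^Fin 2]→L[ℝ] ℝ), Q (c • x) y = c * Q x y := fun c x y ↦
      LinearMap.BilinForm.smul_left c x y
    have h4 : ∀ (c : ℝ) (x y : E [⋀^Fin 2]→L[ℝ] ℝ), Q x (c • y) = c * Q x y := fun c x y ↦
      LinearMap.BilinForm.smul_right c x y
    have hexp : Q (A + t • θ) (A + t • θ) = Q A A + t * Q A θ + (t * Q θ A + t * (t * Q θ θ)) := by
      rw [h1, h2, h2, h3, h3, h4, h4]
    have hQt : Q (A + t • θ) (A + t • θ) = 0 := by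
      rw [hQ]
      have hfam : (fun j ↦ ofRealForm (-(![A + t • θ, A + t • θ] j))) =
          fun _ : Fin 2 ↦ ofRealForm (-(A + t • θ)) := by
        funext j
        fin_cases j <;> rfl
      rw [hfam]
      change (torusIntegral Φ e (wedgePow (ofRealForm (-(A + t • θ))) 2)).re = 0
      rw [hzero, Complex.zero_re]
    have h5 : 0 ≤ t * Q A θ := mul_nonneg ht.le hQAθ
    have h6 : 0 ≤ t * Q θ A := mul_nonneg ht.le hQθA
    have h7 : 0 ≤ t * (t * Q θ θ) := mul_nonneg ht.le (mul_nonneg ht.le hQθθ)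
    linarith

/-- **The effective cone of an abelian surface** (Debarre, 6.3, for line bundles; Bauer, Lemma 2.1
(i) ⟺ (iii) for `g = 2`): a class `η ∈ NS(X)` of a complex abelian surface is algebraically equivalent to an
effective divisor — `c₁(L) = ofRealForm(-η) = Σᵢ [Cᵢ]_e` for curves `Cᵢ`, `e` positively oriented — iff
`(η²) ≥ 0` and `(η·A) ≥ 0`. [cite: Debarre2001, §6 no. 6.3 (the effective cone of an abelian surface)]
[cite: Bauer1998ConeOfCurves, §2 Lemma 2.1 ((i) ⟺ (iii))] -/
theorem IsAbelianVariety.exists_sum_analyticCycleClass_eq_iff_self_nonneg_and_dot_nonneg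
    (hX : IsAbelianVariety Φ) (e : Fin (2 * 2) ≃ ι) (he : orientationSign Φ e = 1) (h : 2 * 1 + 2 = 2 * 2)
    {η A : E [⋀^Fin 2]→L[ℝ] ℝ} (hη : IsNSForm Φ η) (hA : IsRiemannForm Φ A) :
    (∃ (k : ℕ) (Y : Fin k → {Z : Set (ComplexTorus Φ) // HasPureDim 𝓘(ℂ, E) Z 1}),
        ofRealForm (-η) = ∑ i, analyticCycleClass Φ e h (Y i).2) ↔
      0 ≤ (torusIntegral Φ e (wedgeFamily 2 fun j ↦ ofRealForm (-(![η, η] j)))).re ∧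
        0 ≤ (torusIntegral Φ e (wedgeFamily 2 fun j ↦ ofRealForm (-(![η, A] j)))).re := by
  rw [← hX.forall_curve_nonneg_iff_exists_sum_analyticCycleClass_eq Φ e he h hη]
  exact hX.forall_curve_nonneg_iff_self_nonneg_and_dot_nonneg Φ e (Submodule.subset_span hη) hA

/-- **The ample cone of an abelian surface, for real classes** (the Nakai–Moishezon criterion of
Lange–Birkenhake, Cor. 2.2.3, for `g = 2` and real coefficients): for `θ ∈ NS_ℝ(X)` and a polarisation `A` of
a complex abelian surface, `H_θ > 0` iff `(θ²) > 0` and `(θ·A) > 0` (`⇐`: nef by the closed criterion, and a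
nef class with `(θ²) ≠ 0` is ample, §4). [cite: Lange2023AbelianVarietiesComplex, §2.2.1 Cor. 2.2.3]
[cite: Debarre2001, §6 no. 6.3] -/
theorem IsAbelianVariety.forall_pos_iff_self_pos_and_dot_pos (hX : IsAbelianVariety Φ) (e : Fin (2 * 2) ≃ ι)
    {θ A : E [⋀^Fin 2]→L[ℝ] ℝ} (hθ : θ ∈ Submodule.span ℝ {η : E [⋀^Fin 2]→L[ℝ] ℝ | IsNSForm Φ η})
    (hA : IsRiemannForm Φ A) :
    (∀ v : E, v ≠ 0 → 0 < θ ![I • v, v]) ↔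
      0 < (torusIntegral Φ e (wedgeFamily 2 fun j ↦ ofRealForm (-(![θ, θ] j)))).re ∧
        0 < (torusIntegral Φ e (wedgeFamily 2 fun j ↦ ofRealForm (-(![θ, A] j)))).re := by
  have h11θ := type_one_one_of_mem_span_isNSForm Φ hθ
  constructor
  · intro hpos
    refine ⟨torusIntegral_wedgeFamily_re_pos_of_pos Φ e _ (fun j ↦ ?_) (fun j ↦ ?_),
      torusIntegral_wedgeFamily_re_pos_of_pos Φ e _ (fun j ↦ ?_) (fun j ↦ ?_)⟩
    · fin_cases j <;> exact h11θ
    · fin_cases j <;> exact hpos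
    · fin_cases j
      · exact h11θ
      · exact hA.1
    · fin_cases j
      · exact hpos
      · exact hA.2.2
  · rintro ⟨hself, hdot⟩
    have hnef := (hX.forall_curve_nonneg_iff_self_nonneg_and_dot_nonneg Φ e hθ hA).2 ⟨hself.le, hdot.le⟩
    refine (hX.forall_pos_iff_torusIntegral_wedgePow_ne_zero_of_forall_curve_nonneg Φ e hθ hnef).2 fun h0 ↦ ?_
    have hfam : (fun j ↦ ofRealForm (-(![θ, θ] j))) = fun _ : Fin 2 ↦ ofRealForm (-θ) := by
      funext j
      fin_cases j <;> rfl
    rw [hfam] at hself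
    change 0 < (torusIntegral Φ e (wedgePow (ofRealForm (-θ)) 2)).re at hself
    rw [h0, Complex.zero_re] at hself
    exact lt_irrefl _ hself

end Surface

/-! ### §7 The cones `Nef(X)` and `Amp(X)` in `NS_ℝ(X)`: sums, `Amp + Nef ⊆ Amp`, and the numerical
criteria of Bauer (ii) ⟺ (iii) and Lange–Birkenhake Cor. 2.2.3 for real classes -/

section Cones

variable {ι : Type*} [Fintype ι] [DecidableEq ι] {E : Type u} [NormedAddCommGroup E] [InnerProductSpace ℂ E]
  [FiniteDimensional ℂ E] [MeasurableSpace E] [BorelSpace E] (Φ : (ι → ℝ) ≃L[ℝ] E) {g : ℕ}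

omit [DecidableEq ι] in
/-- **A sum of nef classes is nef** (Debarre, 1.24: "a sum of nef divisors is nef"; `∫_C` is additive).
[cite: Debarre2001, 1.24 (sum of nef divisors) and 1.28 (nef ℝ-divisors)] -/
theorem forall_curve_nonneg_add {θ₁ θ₂ : E [⋀^Fin 2]→L[ℝ] ℝ}
    (h₁ : ∀ (C : Set (ComplexTorus Φ)) (hC : HasPureDim 𝓘(ℂ, E) C 1), IsIrreducibleAnalyticSet 𝓘(ℂ, E) C →
      0 ≤ (analyticCyclePeriod Φ hC (ofRealForm (-θ₁))).re)
    (h₂ : ∀ (C : Set (ComplexTorus Φ)) (hC : HasPureDim 𝓘(ℂ, E) C 1), IsIrreducibleAnalyticSet 𝓘(ℂ, E) C →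
      0 ≤ (analyticCyclePeriod Φ hC (ofRealForm (-θ₂))).re)
    (C : Set (ComplexTorus Φ)) (hC : HasPureDim 𝓘(ℂ, E) C 1) (hCi : IsIrreducibleAnalyticSet 𝓘(ℂ, E) C) :
    0 ≤ (analyticCyclePeriod Φ hC (ofRealForm (-(θ₁ + θ₂)))).re := by
  rw [neg_add, ofRealForm_add, map_add, Complex.add_re]
  exact add_nonneg (h₁ C hC hCi) (h₂ C hC hCi)

omit [DecidableEq ι] in
/-- **A non-negative multiple of a nef class is nef** (`Nef(X)` is a cone). [cite: Debarre2001, 1.28 (nef ℝ-divisors)]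
[cite: Bauer1998ConeOfCurves, §4 (the nef cone)] -/
theorem forall_curve_nonneg_smul {θ : E [⋀^Fin 2]→L[ℝ] ℝ} {c : ℝ} (hc : 0 ≤ c)
    (h : ∀ (C : Set (ComplexTorus Φ)) (hC : HasPureDim 𝓘(ℂ, E) C 1), IsIrreducibleAnalyticSet 𝓘(ℂ, E) C →
      0 ≤ (analyticCyclePeriod Φ hC (ofRealForm (-θ))).re)
    (C : Set (ComplexTorus Φ)) (hC : HasPureDim 𝓘(ℂ, E) C 1) (hCi : IsIrreducibleAnalyticSet 𝓘(ℂ, E) C) :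
    0 ≤ (analyticCyclePeriod Φ hC (ofRealForm (-(c • θ)))).re := by
  rw [ofRealForm_neg_smul₅₀, map_smul, smul_eq_mul, Complex.re_ofReal_mul]
  exact mul_nonneg hc (h C hC hCi)

/-- **`Amp(X) + Nef(X) ⊆ Amp(X)`** (Debarre, 1.22: "the sum of a nef divisor and an ample divisor is ample"):
on an abelian variety, for a nef `θ ∈ NS_ℝ(X)` and any `B` with `H_B > 0`, `H_{θ + B} > 0`.
[cite: Debarre2001, 1.22 (sum of ample and nef divisors) and 1.28] -/
theorem IsAbelianVariety.forall_pos_add_of_forall_curve_nonneg (hX : IsAbelianVariety Φ) (e : Fin (2 * g) ≃ ι)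
    {θ B : E [⋀^Fin 2]→L[ℝ] ℝ} (hθ : θ ∈ Submodule.span ℝ {η : E [⋀^Fin 2]→L[ℝ] ℝ | IsNSForm Φ η})
    (hnef : ∀ (C : Set (ComplexTorus Φ)) (hC : HasPureDim 𝓘(ℂ, E) C 1), IsIrreducibleAnalyticSet 𝓘(ℂ, E) C →
      0 ≤ (analyticCyclePeriod Φ hC (ofRealForm (-θ))).re)
    (hB : ∀ v : E, v ≠ 0 → 0 < B ![I • v, v]) (v : E) (hv : v ≠ 0) : 0 < (θ + B) ![I • v, v] := by
  rw [ContinuousAlternatingMap.add_apply]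
  exact add_pos_of_nonneg_of_pos (hX.semipos_of_mem_span_isNSForm_of_forall_curve_nonneg Φ e hθ hnef v) (hB v hv)

/-- **Bauer, Lemma 2.1 (ii) ⟺ (iii), for real classes** (Debarre, 1.28: the numerical characterisations
"are still valid for divisors which are linear combinations with real coefficients"): for `θ ∈ NS_ℝ(X)` and a
polarisation `A` of an abelian variety of dimension `g`, `θ` is nef iff `Re (θ^ν · A^{g-ν}) ≥ 0` for
`ν = 1, …, g`. [cite: Bauer1998ConeOfCurves, §2 Lemma 2.1 ((ii) ⟺ (iii))] [cite: Debarre2001, §1.12 Exercise 7 and 1.28] -/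
theorem IsAbelianVariety.forall_curve_nonneg_iff_forall_re_torusIntegral_mixedFamily_nonneg_of_mem_span
    (hX : IsAbelianVariety Φ) (e : Fin (2 * g) ≃ ι) {θ A : E [⋀^Fin 2]→L[ℝ] ℝ}
    (hθ : θ ∈ Submodule.span ℝ {η : E [⋀^Fin 2]→L[ℝ] ℝ | IsNSForm Φ η}) (hA : IsRiemannForm Φ A) :
    (∀ (C : Set (ComplexTorus Φ)) (hC : HasPureDim 𝓘(ℂ, E) C 1), IsIrreducibleAnalyticSet 𝓘(ℂ, E) C →
        0 ≤ (analyticCyclePeriod Φ hC (ofRealForm (-θ))).re) ↔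
      ∀ ν, 1 ≤ ν → ν ≤ g →
        0 ≤ (torusIntegral Φ e (wedgeFamily g (mixedFamily (ofRealForm (-θ)) (ofRealForm (-A)) g ν))).re := by
  rw [← hX.semipos_iff_forall_curve_of_mem_span Φ e hθ]
  exact semipos_iff_forall_re_torusIntegral_wedgeFamily_mixedFamily_nonneg Φ e hA.1 hA.2.2
    (type_one_one_of_mem_span_isNSForm Φ hθ)

omit [Fintype ι] [DecidableEq ι] [FiniteDimensional ℂ E] [MeasurableSpace E] [BorelSpace E] in
/-- `mixedFamily (ofRealForm (-θ)) (ofRealForm (-A)) g ν` is the family of `ofRealForm (-·)` of the real family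
`(θ, …, θ, A, …, A)`. [folklore] -/
private theorem mixedFamily_ofRealForm_neg_eq (θ A : E [⋀^Fin 2]→L[ℝ] ℝ) (g ν : ℕ) :
    mixedFamily (ofRealForm (-θ)) (ofRealForm (-A)) g ν =
      fun j ↦ ofRealForm (-((fun i : Fin g ↦ if (i : ℕ) < ν then θ else A) j)) := by
  funext j
  simp only [mixedFamily_apply]
  split_ifs <;> rfl

/-- **The Nakai–Moishezon criterion of Lange–Birkenhake (Cor. 2.2.3) for real classes**: for `θ ∈ NS_ℝ(X)`
and a polarisation `A` of an abelian variety of dimension `g`, `H_θ > 0` iff `Re (θ^ν · A^{g-ν}) > 0` for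
`ν = 1, …, g` (`⇐`: nef by the closed criterion, then `(θ^g) ≠ 0` makes a nef real class ample, §4).
[cite: Lange2023AbelianVarietiesComplex, §2.2.1 Cor. 2.2.3] [cite: Debarre2001, §1.12 Exercise 7 (the "ample" half) and 1.28] -/
theorem IsAbelianVariety.forall_pos_iff_forall_re_torusIntegral_mixedFamily_pos_of_mem_span
    (hX : IsAbelianVariety Φ) (e : Fin (2 * g) ≃ ι) {θ A : E [⋀^Fin 2]→L[ℝ] ℝ}
    (hθ : θ ∈ Submodule.span ℝ {η : E [⋀^Fin 2]→L[ℝ] ℝ | IsNSForm Φ η}) (hA : IsRiemannForm Φ A) :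
    (∀ v : E, v ≠ 0 → 0 < θ ![I • v, v]) ↔
      ∀ ν, 1 ≤ ν → ν ≤ g →
        0 < (torusIntegral Φ e (wedgeFamily g (mixedFamily (ofRealForm (-θ)) (ofRealForm (-A)) g ν))).re := by
  have h11θ := type_one_one_of_mem_span_isNSForm Φ hθ
  constructor
  · intro hpos ν _ _
    rw [mixedFamily_ofRealForm_neg_eq]
    refine torusIntegral_wedgeFamily_re_pos_of_pos Φ e _ (fun j ↦ ?_) (fun j ↦ ?_)
    · split_ifs
      exacts [h11θ, hA.1]
    · split_ifs
      exacts [hpos, hA.2.2]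
  · intro h
    have hnef := (hX.forall_curve_nonneg_iff_forall_re_torusIntegral_mixedFamily_nonneg_of_mem_span Φ e hθ
      hA).2 fun ν h₁ h₂ ↦ (h ν h₁ h₂).le
    refine (hX.forall_pos_iff_torusIntegral_wedgePow_ne_zero_of_forall_curve_nonneg Φ e hθ hnef).2 fun h0 ↦ ?_
    rcases Nat.eq_zero_or_pos g with hg | hg
    · -- `g = 0`: `(θ^0) = ∫_X 1 > 0` directly
      subst hg
      have h1 := torusIntegral_wedgeFamily_re_pos_of_pos Φ e (fun _ : Fin 0 ↦ θ) (fun j ↦ j.elim0)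
        (fun j ↦ j.elim0)
      rw [show (wedgeFamily 0 fun j : Fin 0 ↦ ofRealForm (-((fun _ : Fin 0 ↦ θ) j))) = wedgePow (ofRealForm (-θ)) 0
        from rfl, h0, Complex.zero_re] at h1
      exact lt_irrefl _ h1
    · have hg' := h g hg le_rfl
      have hfam : mixedFamily (ofRealForm (-θ)) (ofRealForm (-A)) g g = fun _ ↦ ofRealForm (-θ) := by
        funext j
        simp only [mixedFamily_apply, if_pos j.2]
      rw [hfam] at hg'
      change 0 < (torusIntegral Φ e (wedgePow (ofRealForm (-θ)) g)).re at hg'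
      rw [h0, Complex.zero_re] at hg'
      exact lt_irrefl _ hg'

/-- **The nef cone is closed in `NS_ℝ(X)`** (Bauer, §4; Debarre, §1.7: the nef cone is the CLOSURE of the
ample cone): a class `θ ∈ NS_ℝ(X)` in the closure (for the norm topology of `2`-forms) of the nef classes of
`NS_ℝ(X)` is nef — semi-positivity `H ≥ 0` is a closed condition and equals nefness on `NS_ℝ(X)` (§2).
[cite: Bauer1998ConeOfCurves, §4 (the nef cone)] [cite: Debarre2001, §1.7 (the ample cone and its closure) and 1.28] -/
theorem IsAbelianVariety.forall_curve_nonneg_of_mem_closure (hX : IsAbelianVariety Φ) (e : Fin (2 * g) ≃ ι)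
    {θ : E [⋀^Fin 2]→L[ℝ] ℝ} (hθ : θ ∈ Submodule.span ℝ {η : E [⋀^Fin 2]→L[ℝ] ℝ | IsNSForm Φ η})
    (hcl : θ ∈ closure {θ' : E [⋀^Fin 2]→L[ℝ] ℝ | θ' ∈ Submodule.span ℝ {η : E [⋀^Fin 2]→L[ℝ] ℝ | IsNSForm Φ η} ∧
      ∀ (C : Set (ComplexTorus Φ)) (hC : HasPureDim 𝓘(ℂ, E) C 1), IsIrreducibleAnalyticSet 𝓘(ℂ, E) C →
        0 ≤ (analyticCyclePeriod Φ hC (ofRealForm (-θ'))).re})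
    (C : Set (ComplexTorus Φ)) (hC : HasPureDim 𝓘(ℂ, E) C 1) (hCi : IsIrreducibleAnalyticSet 𝓘(ℂ, E) C) :
    0 ≤ (analyticCyclePeriod Φ hC (ofRealForm (-θ))).re := by
  have hclosed : IsClosed {θ' : E [⋀^Fin 2]→L[ℝ] ℝ | ∀ v : E, 0 ≤ θ' ![I • v, v]} := by
    have hset : {θ' : E [⋀^Fin 2]→L[ℝ] ℝ | ∀ v : E, 0 ≤ θ' ![I • v, v]} =
        ⋂ v : E, {θ' : E [⋀^Fin 2]→L[ℝ] ℝ | 0 ≤ θ' ![I • v, v]} := by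
      ext θ'
      simp only [mem_setOf_eq, mem_iInter]
    rw [hset]
    exact isClosed_iInter fun v ↦ isClosed_le continuous_const (continuous_eval_const _)
  have hsub : {θ' : E [⋀^Fin 2]→L[ℝ] ℝ | θ' ∈ Submodule.span ℝ {η : E [⋀^Fin 2]→L[ℝ] ℝ | IsNSForm Φ η} ∧
      ∀ (C : Set (ComplexTorus Φ)) (hC : HasPureDim 𝓘(ℂ, E) C 1), IsIrreducibleAnalyticSet 𝓘(ℂ, E) C →
        0 ≤ (analyticCyclePeriod Φ hC (ofRealForm (-θ'))).re} ⊆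
      {θ' : E [⋀^Fin 2]→L[ℝ] ℝ | ∀ v : E, 0 ≤ θ' ![I • v, v]} :=
    fun θ' hθ' ↦ (hX.semipos_iff_forall_curve_of_mem_span Φ e hθ'.1).2 hθ'.2
  have hθpsd : ∀ v : E, 0 ≤ θ ![I • v, v] := (hclosed.closure_subset_iff.2 hsub) hcl
  exact (hX.semipos_iff_forall_curve_of_mem_span Φ e hθ).1 hθpsd C hC hCi

end Cones

end ComplexTorus

end Literature.Geometry.Kaehler

end
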